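import Literature.Barriers.CriticalPhenomena.LaceExpansionIsingGreenUniform
import Literature.Barriers.CriticalPhenomena.LaceExpansionIsingDeconvolutionParts
import Literature.Barriers.CriticalPhenomena.LaceExpansionPcLimit
import HarnessLib

/-!
# The impulse equation in Fourier space and Liu–Slade's bootstrap function `b(z)` as a real
# function (tools for the proof of Theorem 1.7, §2.2)

Barrier catalogue `Literature/Barriers/CriticalPhenomena/` (D-0021), a companion of the Ising entry
`LaceExpansionIsingAboveFour`. The deconvolution theorem `LiuSlade2026_thm1_7` (Liu–Slade 2026,
Thm. 1.7, corrected transcription; `…Deconvolution.lean`) — one of the two remaining named facts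
behind `SpreadOutIsing.Sakai2007_thm13_spreadOut` (`Sakai2007_thm13_spreadOut_of_two_facts`,
`…GreenDecay.lean`) — is decomposed in `LaceExpansionIsingDeconvolutionParts.lean` (objects
`fourierInverseG` = `𝒢_z` of (2.1), `lsF`, `lsLambda`, `lsMu`, the named fact `LiuSlade2026_thm22`),
and the forbidden-interval step of its proof (§2.2) is proved on the sublevel predicates
`LSBootstrapLE … t` ("`b(z) ≤ t`") in `LaceExpansionIsingDeconvolutionBootstrap.lean`
(`forall_lsBootstrapLE_two`, `lsBootstrapLE_of_forall_lt`, `lsBootstrapLE_one_of_le_green`), the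
abstract bootstrap lemma being `Slade2006_lem59` (`LaceExpansionConvergence.lean`). This file adds two
small PROVED ingredients (no named facts):

* the IMPULSE EQUATION IN FOURIER SPACE (proof of Prop. 2.3: "Since `G_z` satisfies `F_z * G_z = δ`
  and both `F_z` and `G_z` are summable, we have `F̂_z(k)Ĝ_z(k) = 1` and hence `G_z` is equal to
  the Fourier integral `𝒢_z` of (2.1)"): `latticeFT_mul_eq_one_of_conv_eq_delta` (`F̂ Ĝ = 1`),
  `eq_integral_inv_latticeFT_of_conv_eq_delta` (`G(x) = ∫_{[-π,π]^d} e^{ik·x}/F̂(k) dk/(2π)^d`, a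
  stepping stone), `coe_eq_haraH_of_conv_eq_delta` (`G(x) = haraH (δ₀ - F) δ₀ x`, Hara's framework
  of `LaceExpansionXSpaceAsymptotics.lean`) and `eq_fourierInverseG_of_conv_eq_delta`
  (`G = fourierInverseG F`, the form in which `LiuSlade2026_thm22` is stated), built on the tree's
  `ℓ¹` convolution theorem `latticeFT_tsum_mul_sub` (`LaceExpansionPcLimit.lean`), inversion formula
  `integral_cexp_kdot_mul_latticeFT` (`LaceExpansionPcInputs.lean`), `δ̂₀ = 1`, `1 - (δ₀ - F)^ = F̂` and
  `fourierInverseG_eq_re_haraH` (`…DeconvolutionParts.lean`), all imported, not restated;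
* the BOOTSTRAP FUNCTION AS A REAL FUNCTION under `LSAssumptionG` (Assumption 1.3):
  `bootWeight G z x = G_z(x)|x|^{d-2}`, `bootSup G z = sup_{x≠0} bootWeight G z x`, and Liu–Slade's
  `b` of (1.12) itself, `bootB L ε K_S G z = max(bootSup G z/(K_S L^{-(2-ε)}), 3(z-1))`; finiteness
  below `z_c` (`bddAbove_range_bootWeight`, decay (ii)), the bridges `lsBootstrapLE_iff` and
  `lsBootstrapLE_iff_bootB_le` (`LSBootstrapLE … (G z) z t ↔ b(z) ≤ t`, `K_S > 0`, `L ≥ 1`), the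
  CONTINUITY of `bootSup` and `bootB` on `[1, z_c)` (`continuousOn_bootSup`, `continuousOn_bootB` —
  the sentence "The function `b(z)` is finite and continuous in `z ∈ [1,z_c)` by Assumption 1.3
  (ii)–(iii)" of §1.2.2, by the finite-exceptional-set argument: monotonicity (iii) reduces `[1,z'']`
  to the decay (ii) at one `z'' < z_c`), and the first paragraph of the proof of Theorem 1.7 for the
  literal `b` (`bootB_le_two`: `b(1) ≤ 1` and (`b ≤ 3 ⇒ b ≤ 2`) give `b ≤ 2` on `[1, z_c)`, through
  `Slade2006_lem59`; also `bootSup_forbidden_interval`).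

## References

* Y. Liu, G. Slade, *Gaussian deconvolution and the lace expansion for spread-out models*, Ann.
  Inst. H. Poincaré Probab. Statist. (2026), arXiv:2310.07640: §1.1 (1.4), (1.12) (bootstrap
  function), §1.2.2 (continuity of `b`), §2.1 (2.1) (`𝒢_z`), §2.2 (Prop. 2.3 and the proof of
  Thm. 1.7) [LiuSlade2026].
* T. Hara, R. van der Hofstad, G. Slade, Ann. Probab. 31 (2003) 349–408, arXiv:math-ph/0011046, §2
  (the bootstrap lemma; step (i) of the proof of the bound on `G_{z_c}`: continuity of the
  supremum) [HaraHofstadSlade2003].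
* G. Slade, *The Lace Expansion and its Applications*, LNM 1879 (2006), Lemma 5.9 (the bootstrap
  lemma, `Slade2006_lem59`) [Slade2006LaceExpansion].
-/

noncomputable section

namespace Literature.Barriers.CriticalPhenomena

open _root_.MeasureTheory Filter _root_.Topology Finset Literature.Probability.LatticeModels
open SpreadOutIsing (delta0 latticeConv latticeFT_delta0 one_sub_latticeFT_delta0_sub fourierInverseG
  fourierInverseG_eq_re_haraH)
open scoped BigOperators

variable {d : ℕ}

/-! ## The impulse equation in Fourier space -/

/-- **`F * G = δ` with `F, G ∈ ℓ¹` gives `F̂ Ĝ = 1`** (so `F̂` never vanishes).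
[cite: LiuSlade2026, §2.2, proof of Proposition 2.3] -/
theorem latticeFT_mul_eq_one_of_conv_eq_delta {F G : Site d → ℝ} (hF : Summable fun x => |F x|)
    (hG : Summable fun x => |G x|) (h : ∀ x, latticeConv F G x = delta0 x) (k : Fin d → ℝ) :
    latticeFT F k * latticeFT G k = 1 := by
  rw [← latticeFT_delta0 (d := d) k, ← show latticeConv F G = delta0 from funext h]
  exact (latticeFT_tsum_mul_sub hF hG k).symm

/-- **The solution of the impulse equation is the Fourier integral of `1/F̂`**: if `F * G = δ`
with `F, G ∈ ℓ¹(ℤ^d)`, then `G(x) = ∫_{[-π,π]^d} e^{ik·x}/F̂(k) dk/(2π)^d` — "hence `G_z` is equal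
to the Fourier integral `𝒢_z` of (2.1)" (Liu–Slade 2026, proof of Prop. 2.3).
[cite: LiuSlade2026, §2.2, proof of Proposition 2.3, with (2.1)] -/
theorem eq_integral_inv_latticeFT_of_conv_eq_delta {F G : Site d → ℝ}
    (hF : Summable fun x => |F x|) (hG : Summable fun x => |G x|)
    (h : ∀ x, latticeConv F G x = delta0 x) (x : Site d) :
    (G x : ℂ) = ((2 * Real.pi : ℂ) ^ d)⁻¹ *
      ∫ k in cube d, Complex.exp (Complex.I * (kdot k x : ℂ)) / latticeFT F k := by
  have hone := latticeFT_mul_eq_one_of_conv_eq_delta hF hG h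
  have hinv : ∀ k, latticeFT G k = (latticeFT F k)⁻¹ := fun k =>
    eq_inv_of_mul_eq_one_right (hone k)
  have hI := integral_cexp_kdot_mul_latticeFT hG x
  have hπ : ((2 * Real.pi : ℂ) ^ d) ≠ 0 := pow_ne_zero _ (by
    exact_mod_cast (mul_pos two_pos Real.pi_pos).ne')
  rw [eq_inv_mul_iff_mul_eq₀ hπ, ← hI]
  refine integral_congr_ae (ae_of_all _ fun k => ?_)
  show Complex.exp (Complex.I * (kdot k x : ℂ)) * latticeFT G k =
    Complex.exp (Complex.I * (kdot k x : ℂ)) / latticeFT F k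
  rw [hinv k, div_eq_mul_inv]

/-- **The same in Hara's framework**: if `F * G = δ` with `F, G ∈ ℓ¹`, then `G(x) = H(x)` for Hara's
`H(x) = ∫ e^{ik·x} ĝ(k)/(1 - Ĵ(k)) dk/(2π)^d` (`haraH`, `LaceExpansionXSpaceAsymptotics.lean`) with
source `g = δ₀` and kernel `J = δ₀ - F` (`1 - Ĵ = F̂`, `one_sub_latticeFT_delta0_sub`) — the
integral by which the tree phrases Liu–Slade's `𝒢_z` (`fourierInverseG_eq_re_haraH`,
`LaceExpansionIsingDeconvolutionParts.lean`). [cite: LiuSlade2026, §2.2, proof of Proposition 2.3, with (2.1)] -/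
theorem coe_eq_haraH_of_conv_eq_delta {F G : Site d → ℝ}
    (hF : Summable fun x => |F x|) (hG : Summable fun x => |G x|)
    (h : ∀ x, latticeConv F G x = delta0 x) (x : Site d) :
    (G x : ℂ) = haraH (fun y => delta0 y - F y) delta0 x := by
  rw [eq_integral_inv_latticeFT_of_conv_eq_delta hF hG h x]
  unfold haraH haraIntegrand
  rw [div_eq_inv_mul]
  congr 1
  refine integral_congr_ae (ae_of_all _ fun k => ?_)
  show Complex.exp (Complex.I * (kdot k x : ℂ)) / latticeFT F k =
    Complex.exp (Complex.I * (kdot k x : ℂ)) *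
      (latticeFT delta0 k / (1 - latticeFT (fun y => delta0 y - F y) k))
  rw [latticeFT_delta0, one_sub_latticeFT_delta0_sub hF, mul_one_div]

/-- **"Hence `G_z` is equal to the Fourier integral `𝒢_z` of (2.1)"** (Liu–Slade 2026, proof of
Prop. 2.3), in the form consumed by the named fact `LiuSlade2026_thm22`: a solution `G ∈ ℓ¹` of the
impulse equation `F * G = δ` with `F ∈ ℓ¹` equals `fourierInverseG F`
(`LaceExpansionIsingDeconvolutionParts.lean`: `𝒢 = Re ∫_{(ℝ/ℤ)^d} e^{-2πit·x}/F̂(t) dt`).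
[cite: LiuSlade2026, §2.2, proof of Proposition 2.3, with (2.1)] -/
theorem eq_fourierInverseG_of_conv_eq_delta {F G : Site d → ℝ}
    (hF : Summable fun x => |F x|) (hG : Summable fun x => |G x|)
    (h : ∀ x, latticeConv F G x = delta0 x) (x : Site d) : G x = fourierInverseG F x := by
  rw [fourierInverseG_eq_re_haraH hF, ← coe_eq_haraH_of_conv_eq_delta hF hG h x, Complex.ofReal_re]


/-! ## The bootstrap function of a family `G_z` under Liu–Slade's Assumption 1.3 -/

namespace SpreadOutIsing

variable {L : ℕ}

/-- The weighted two-point function `g_x(z) = G_z(x) |x|^{d-2}` whose supremum over `x ≠ 0` is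
(up to the constant `K_S L^{-2+ε}`) Liu–Slade's bootstrap function `b(z)` of (1.12).
[cite: LiuSlade2026, (1.12) (the bootstrap function b)] -/
def bootWeight (G : ℝ → Site d → ℝ) (z : ℝ) (x : Site d) : ℝ :=
  G z x * euclidNorm x ^ ((d : ℝ) - 2)

/-- `S(z) = sup_{x ≠ 0} G_z(x)|x|^{d-2}` (a conditionally complete supremum; it is a genuine
supremum for `z < z_c` under Assumption 1.3 (ii), `bddAbove_range_bootWeight`).
[cite: LiuSlade2026, (1.12) (the bootstrap function b)] -/
def bootSup (G : ℝ → Site d → ℝ) (z : ℝ) : ℝ :=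
  ⨆ x : {x : Site d // x ≠ 0}, bootWeight G z x.1

/-- `ℤ^d ∖ {0}` is nonempty for `d ≥ 1`. [folklore] -/
theorem nonempty_ne_zero (hd : 1 ≤ d) : Nonempty {x : Site d // x ≠ 0} :=
  ⟨⟨Pi.single ⟨0, hd⟩ 1, fun h => by have := congrFun h ⟨0, hd⟩; simp at this⟩⟩

variable {G : ℝ → Site d → ℝ} {zc : ℝ}

/-- `g_x(z) ≥ 0` on `[1, z_c]`. [cite: LiuSlade2026, Assumption 1.3 (G_z ≥ 0)] -/
theorem bootWeight_nonneg (hA : LSAssumptionG d L G zc) {z : ℝ} (hz : z ∈ Set.Icc 1 zc)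
    (x : Site d) : 0 ≤ bootWeight G z x :=
  mul_nonneg (hA.nonneg z hz x) (Real.rpow_nonneg (euclidNorm_nonneg x) _)

/-- `g_x` is nondecreasing in `z ∈ [1, z_c]`. [cite: LiuSlade2026, Assumption 1.3 (iii)] -/
theorem bootWeight_mono (hA : LSAssumptionG d L G zc) {z z' : ℝ} (hz : z ∈ Set.Icc 1 zc)
    (hz' : z' ∈ Set.Icc 1 zc) (hle : z ≤ z') (x : Site d) : bootWeight G z x ≤ bootWeight G z' x :=
  mul_le_mul_of_nonneg_right (hA.monotoneOn x hz hz' hle) (Real.rpow_nonneg (euclidNorm_nonneg x) _)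

/-- **For `z < z_c` the weights are bounded** (Assumption 1.3 (ii): `G_z(x)|x|^{d-2} → 0`, so
all but finitely many weights are `< 1`). [cite: LiuSlade2026, §1.2.2 ("The function b(z) is finite … by Assumption 1.3 (ii)–(iii)")] -/
theorem bddAbove_range_bootWeight (hA : LSAssumptionG d L G zc) {z : ℝ} (hz : z ∈ Set.Ico 1 zc) :
    BddAbove (Set.range fun x : {x : Site d // x ≠ 0} => bootWeight G z x.1) := by
  have hev : ∀ᶠ x in cofinite, bootWeight G z x < 1 :=
    (hA.decay_subcrit z hz).eventually_lt_const one_pos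
  have hfin : {x : Site d | ¬bootWeight G z x < 1}.Finite := Filter.eventually_cofinite.1 hev
  have hzI : z ∈ Set.Icc 1 zc := Set.Ico_subset_Icc_self hz
  refine ⟨1 + ∑ y ∈ hfin.toFinset, bootWeight G z y, ?_⟩
  rintro _ ⟨⟨x, hx⟩, rfl⟩
  have hsum : 0 ≤ ∑ y ∈ hfin.toFinset, bootWeight G z y :=
    Finset.sum_nonneg fun y _ => bootWeight_nonneg hA hzI y
  by_cases hxF : x ∈ hfin.toFinset
  · have := Finset.single_le_sum (fun y _ => bootWeight_nonneg hA hzI y) hxF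
    simp only
    linarith
  · rw [Set.Finite.mem_toFinset, Set.mem_setOf_eq, not_not] at hxF
    simp only
    linarith

/-- `g_x(z) ≤ S(z)` for `x ≠ 0` (when the weights are bounded). [folklore] -/
theorem bootWeight_le_bootSup {z : ℝ}
    (hbdd : BddAbove (Set.range fun x : {x : Site d // x ≠ 0} => bootWeight G z x.1))
    {x : Site d} (hx : x ≠ 0) : bootWeight G z x ≤ bootSup G z :=
  le_ciSup hbdd ⟨x, hx⟩

/-- `S(z) ≤ t` as soon as every weight is `≤ t` (`d ≥ 1`). [folklore] -/
theorem bootSup_le (hd : 1 ≤ d) {z t : ℝ} (h : ∀ x : Site d, x ≠ 0 → bootWeight G z x ≤ t) :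
    bootSup G z ≤ t := by
  haveI := nonempty_ne_zero (d := d) hd
  exact ciSup_le fun x => h x.1 x.2

/-- `S(z) ≥ 0` for `z ∈ [1, z_c)`. [folklore] -/
theorem bootSup_nonneg (hd : 1 ≤ d) (hA : LSAssumptionG d L G zc) {z : ℝ} (hz : z ∈ Set.Ico 1 zc) :
    0 ≤ bootSup G z := by
  obtain ⟨⟨x, hx⟩⟩ := nonempty_ne_zero (d := d) hd
  exact (bootWeight_nonneg hA (Set.Ico_subset_Icc_self hz) x).trans
    (bootWeight_le_bootSup (bddAbove_range_bootWeight hA hz) hx)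

/-- **Link with `LSBootstrapLE`**: for `z < z_c`, `b(z) ≤ t` in the sense of `LSBootstrapLE`
(every `G_z(x) ≤ t K_S L^{-(2-ε)}|x|^{-(d-2)}` and `3(z-1) ≤ t`) iff
`S(z) ≤ t K_S L^{-(2-ε)}` and `3(z-1) ≤ t` (`d ≥ 1`).
[cite: LiuSlade2026, (1.12) (the bootstrap function b)] -/
theorem lsBootstrapLE_iff (hd : 1 ≤ d) (hA : LSAssumptionG d L G zc) {ε K_S z t : ℝ}
    (hz : z ∈ Set.Ico 1 zc) :
    LSBootstrapLE d L ε K_S (G z) z t ↔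
      bootSup G z ≤ t * (K_S * (L : ℝ) ^ (-(2 - ε))) ∧ 3 * (z - 1) ≤ t := by
  have hbdd := bddAbove_range_bootWeight hA hz
  have hpow : ∀ x : Site d, x ≠ 0 → 0 < euclidNorm x ^ ((d : ℝ) - 2) := fun x hx =>
    Real.rpow_pos_of_pos (lt_of_lt_of_le one_pos (one_le_euclidNorm_of_ne_zero hx)) _
  have hkey : ∀ x : Site d, x ≠ 0 →
      (G z x ≤ t * (K_S * (L : ℝ) ^ (-(2 - ε)) * euclidNorm x ^ (-((d : ℝ) - 2))) ↔
        bootWeight G z x ≤ t * (K_S * (L : ℝ) ^ (-(2 - ε)))) := by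
    intro x hx
    have hp := hpow x hx
    rw [bootWeight, Real.rpow_neg (euclidNorm_nonneg x), ← div_eq_mul_inv, ← mul_div_assoc,
      le_div_iff₀ hp]
  unfold LSBootstrapLE
  constructor
  · rintro ⟨h1, h2⟩
    exact ⟨bootSup_le hd fun x hx => (hkey x hx).1 (h1 x hx), h2⟩
  · rintro ⟨h1, h2⟩
    exact ⟨fun x hx => (hkey x hx).2 ((bootWeight_le_bootSup hbdd hx).trans h1), h2⟩

/-- **Liu–Slade's bootstrap function `b(z)` of (1.12), literally**:
`b(z) = max{ sup_{x≠0} G_z(x)/(K_S L^{-2+ε}|x|^{-(d-2)}), 3(z-1) } = max(S(z)/(K_S L^{-(2-ε)}), 3(z-1))`.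
[cite: LiuSlade2026, (1.12) (the bootstrap function b)] -/
def bootB (L : ℕ) (ε K_S : ℝ) (G : ℝ → Site d → ℝ) (z : ℝ) : ℝ :=
  max (bootSup G z / (K_S * (L : ℝ) ^ (-(2 - ε)))) (3 * (z - 1))

/-- **`b(z) ≤ t` is the predicate `LSBootstrapLE`** (`K_S > 0`, `L ≥ 1`, `d ≥ 1`, `z < z_c`).
[cite: LiuSlade2026, (1.12) (the bootstrap function b)] -/
theorem lsBootstrapLE_iff_bootB_le (hd : 1 ≤ d) (hL : 1 ≤ L) (hA : LSAssumptionG d L G zc)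
    {ε K_S z t : ℝ} (hK : 0 < K_S) (hz : z ∈ Set.Ico 1 zc) :
    LSBootstrapLE d L ε K_S (G z) z t ↔ bootB L ε K_S G z ≤ t := by
  have hL0 : (0 : ℝ) < L := by exact_mod_cast (by omega : 0 < L)
  have hc : 0 < K_S * (L : ℝ) ^ (-(2 - ε)) := mul_pos hK (Real.rpow_pos_of_pos hL0 _)
  rw [lsBootstrapLE_iff hd hA hz, bootB, max_le_iff, div_le_iff₀ hc]

/-- **Continuity of the bootstrap supremum below the critical point** — "The function `b(z)` is
finite and continuous in `z ∈ [1, z_c)` by Assumption 1.3 (ii)–(iii)" (Liu–Slade 2026, §1.2.2),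
with the argument written out: fix `z₀ < z'' < z_c`; by monotonicity (iii) every weight on
`[1, z'']` is dominated by its value at `z''`, and by the decay (ii) at `z''` all but finitely many
of those are `< η`; the finitely many remaining weights are continuous at `z₀` (iii); hence
`|S(z) - S(z₀)| ≤ η` near `z₀`. (Hara–van der Hofstad–Slade 2003, §2, step (i) of the proof of the bound on `G_{z_c}`, argue
the same way through exponential decay.) [cite: LiuSlade2026, §1.2.2 (continuity of b(z) on [1, z_c) from Assumption 1.3 (ii)–(iii))]
[cite: HaraHofstadSlade2003, §2, step (i) of the proof of the x-space bound on G_{z_c} (the supremum is attained on a finite set, hence continuous)] -/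
theorem continuousOn_bootSup (hd : 1 ≤ d) (hA : LSAssumptionG d L G zc) :
    ContinuousOn (bootSup G) (Set.Ico 1 zc) := by
  intro z₀ hz₀
  rw [ContinuousWithinAt, Metric.tendsto_nhds]
  intro ε hε
  set η : ℝ := ε / 2 with hη
  have hηpos : 0 < η := by positivity
  set z'' : ℝ := (z₀ + zc) / 2 with hz''def
  have hz'' : z₀ < z'' ∧ z'' < zc := by constructor <;> [skip; skip] <;> rw [hz''def] <;> linarith [hz₀.1, hz₀.2]
  have hz''I : z'' ∈ Set.Ico 1 zc := ⟨by linarith [hz₀.1], hz''.2⟩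
  have hz''Icc : z'' ∈ Set.Icc 1 zc := Set.Ico_subset_Icc_self hz''I
  have hz₀Icc : z₀ ∈ Set.Icc 1 zc := Set.Ico_subset_Icc_self hz₀
  -- the finite exceptional set at `z''`
  have hev : ∀ᶠ x in cofinite, bootWeight G z'' x < η :=
    (hA.decay_subcrit z'' hz''I).eventually_lt_const hηpos
  have hfin : {x : Site d | ¬bootWeight G z'' x < η}.Finite := Filter.eventually_cofinite.1 hev
  -- continuity of the finitely many exceptional weights at `z₀`
  have hcont : ∀ x : Site d, ContinuousWithinAt (fun z => bootWeight G z x) (Set.Ico 1 zc) z₀ :=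
    fun x => ((hA.continuousOn x).mono Set.Ico_subset_Icc_self z₀ hz₀).mul
      continuousWithinAt_const
  have hnear : ∀ᶠ z in 𝓝[Set.Ico 1 zc] z₀, ∀ x ∈ hfin.toFinset,
      dist (bootWeight G z x) (bootWeight G z₀ x) < η :=
    (Finset.eventually_all hfin.toFinset).2 fun x _ => Metric.tendsto_nhds.1 (hcont x) η hηpos
  have hlt : ∀ᶠ z in 𝓝[Set.Ico 1 zc] z₀, z < z'' :=
    mem_nhdsWithin_of_mem_nhds (Iio_mem_nhds hz''.1)
  have hmem : ∀ᶠ z in 𝓝[Set.Ico 1 zc] z₀, z ∈ Set.Ico 1 zc := self_mem_nhdsWithin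
  filter_upwards [hnear, hlt, hmem] with z hnz hzlt hzI
  have hzIcc : z ∈ Set.Icc 1 zc := Set.Ico_subset_Icc_self hzI
  have hbddz := bddAbove_range_bootWeight hA hzI
  have hbdd0 := bddAbove_range_bootWeight hA hz₀
  have hS0 := bootSup_nonneg hd hA hz₀
  have hSz := bootSup_nonneg hd hA hzI
  -- outside the exceptional set every weight on `[1, z'']` is `< η`
  have hsmall : ∀ {w : ℝ}, w ∈ Set.Icc 1 zc → w ≤ z'' → ∀ x : Site d, x ∉ hfin.toFinset →
      bootWeight G w x < η := by
    intro w hw hwle x hxF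
    rw [Set.Finite.mem_toFinset, Set.mem_setOf_eq, not_not] at hxF
    exact lt_of_le_of_lt (bootWeight_mono hA hw hz''Icc hwle x) hxF
  have key1 : bootSup G z ≤ bootSup G z₀ + η := by
    refine bootSup_le hd fun x hx => ?_
    by_cases hxF : x ∈ hfin.toFinset
    · have h := hnz x hxF
      rw [Real.dist_eq] at h
      linarith [(abs_lt.1 h).2, bootWeight_le_bootSup hbdd0 hx]
    · linarith [hsmall hzIcc hzlt.le x hxF]
  have key2 : bootSup G z₀ ≤ bootSup G z + η := by
    refine bootSup_le hd fun x hx => ?_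
    by_cases hxF : x ∈ hfin.toFinset
    · have h := hnz x hxF
      rw [Real.dist_eq] at h
      linarith [(abs_lt.1 h).1, bootWeight_le_bootSup hbddz hx]
    · linarith [hsmall hz₀Icc hz''.1.le x hxF]
  rw [Real.dist_eq, abs_lt]
  constructor <;> linarith

/-- **The forbidden interval for the sup function** (the abstract bootstrap lemma
`Slade2006_lem59` applied to the continuous `S = bootSup G` on `[1, z_c)`): if `S(1) ≤ a` and, for
`z ∈ (1, z_c)`, `S(z) ≤ b` implies `S(z) ≤ a` (`a < b`), then `S ≤ a` on `[1, z_c)`. Through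
`lsBootstrapLE_iff` this is the sup-function form of `forall_lsBootstrapLE_two`
(`LaceExpansionIsingDeconvolutionBootstrap.lean`).
[cite: LiuSlade2026, §2.2, proof of Theorem 1.7 (the interval (2,3] is forbidden)]
[cite: Slade2006LaceExpansion, Lemma 5.9] -/
theorem bootSup_forbidden_interval (hd : 1 ≤ d) (hA : LSAssumptionG d L G zc) {a b : ℝ}
    (hab : a < b) (h1 : bootSup G 1 ≤ a)
    (hstep : ∀ z ∈ Set.Ioo 1 zc, bootSup G z ≤ b → bootSup G z ≤ a) :
    ∀ z ∈ Set.Ico 1 zc, bootSup G z ≤ a :=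
  Slade2006_lem59 hab (continuousOn_bootSup hd hA) h1 hstep

/-- **`b` is continuous on `[1, z_c)`** ("The function `b(z)` is finite and continuous in
`z ∈ [1,z_c)`", Liu–Slade 2026, §1.2.2). [cite: LiuSlade2026, §1.2.2 (continuity of b(z) on [1, z_c))] -/
theorem continuousOn_bootB (hd : 1 ≤ d) (hA : LSAssumptionG d L G zc) (ε K_S : ℝ) :
    ContinuousOn (bootB L ε K_S G) (Set.Ico 1 zc) := by
  have h3 : Continuous fun z : ℝ => 3 * (z - 1) := by fun_prop
  show ContinuousOn (fun z => max (bootSup G z / (K_S * (L : ℝ) ^ (-(2 - ε)))) (3 * (z - 1)))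
    (Set.Ico 1 zc)
  exact ContinuousOn.sup ((continuousOn_bootSup hd hA).div_const _) h3.continuousOn

/-- **The first paragraph of the proof of Theorem 1.7 for the literal `b`** (Liu–Slade 2026, §2.2):
"By Proposition 2.3 and continuity of the function `b`, the interval `(2,3]` is forbidden for values
of `b(z)` when `z ∈ [1, z_c)`. Since `b(1) ≤ 1` …, we must have `b(z) ≤ 2` for all `z ∈ [1, z_c)`" —
here with Prop. 2.3 as the hypothesis `hstep` and `b(1) ≤ 1` as `h1` (the sublevel-predicate form,
with the passage to `z_c`, is `forall_lsBootstrapLE_two` of `LaceExpansionIsingDeconvolutionBootstrap.lean`).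
[cite: LiuSlade2026, §2.2, proof of Theorem 1.7 (first paragraph)] [cite: Slade2006LaceExpansion, Lemma 5.9] -/
theorem bootB_le_two (hd : 1 ≤ d) (hA : LSAssumptionG d L G zc) (ε K_S : ℝ)
    (h1 : bootB L ε K_S G 1 ≤ 1)
    (hstep : ∀ z ∈ Set.Ioo 1 zc, bootB L ε K_S G z ≤ 3 → bootB L ε K_S G z ≤ 2) :
    ∀ z ∈ Set.Ico 1 zc, bootB L ε K_S G z ≤ 2 :=
  Slade2006_lem59 (by norm_num : (2 : ℝ) < 3) (continuousOn_bootB hd hA ε K_S)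
    (h1.trans (by norm_num)) hstep

end SpreadOutIsing

end Literature.Barriers.CriticalPhenomena

end
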